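import Literature.Geometry.Manifold.DeRhamProductDefect
import Literature.AlgebraicTopology.SingularHomology.LerayHirschTransport
import HarnessLib

/-!
# The two sides of the product defect vanish for an exact second factor

Continuing `DeRhamProductDefect.lean`: if the closed `l`-form `β` on `N` has ZERO class in
`Hˡ(Ω•(N))` (it is exact), then both sides vanish identically,

* `lhs N hW β k n h = 0` (`lhs_eq_zero_of_closedToLocalHomology_eq_zero`): for `β = dγ` and a
  cocycle `η` of `Ω•(W)`, `π₁^* η ∧ π₂^* β = (-1)ᵏ d(π₁^* η ∧ π₂^* γ)` on `π₁⁻¹ W` (Leibniz rule,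
  `d_W η = 0`), a coboundary of `Ω•(π₁⁻¹ W)`;
* `rhs N hW β k n h = 0` (`rhs_eq_zero_of_closedToLocalHomology_eq_zero`): the good representative
  `b_β` is then a coboundary, hence so is `π₂^♯ b_β`, and `⌣` with a coboundary is zero on
  cohomology (`SimplexSpan.cupRightH_congr`, `cupRightH_zero_cochain`).

Used for the restriction of `β` to a handlebody of `N` on which it becomes exact.
Everything is proved; no named facts.

## References

* [BottTu1982Forms] R. Bott, L. W. Tu, *Differential Forms in Algebraic Topology* (1982), §I.5.
* [HatcherAT2002] A. Hatcher, *Algebraic Topology*, CUP 2002, Lemma 3.6, Prop. 3.10.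
-/

noncomputable section

-- see "Implementation notes" in `…SingularHomology.SingularChainsConcrete`
set_option backward.isDefEq.respectTransparency false

open scoped Manifold ContDiff Topology
open CategoryTheory Limits Set Filter Literature.AlgebraicTopology.SingularHomology Literature.Geometry.Kaehler
  Literature.NumberTheory.Transcendental

universe u

/-! ### Leibniz: `d(π₁^* η ∧ π₂^* γ) = (-1)ᵏ π₁^* η ∧ π₂^* dγ` for a `W`-cocycle `η` -/

namespace Literature.Geometry.Kaehler.MForm

variable {E : Type u} [NormedAddCommGroup E] [NormedSpace ℝ E] {H : Type u} [TopologicalSpace H]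
  {I : ModelWithCorners ℝ E H} {M : Type u} [TopologicalSpace M] [ChartedSpace H M]
  {E' : Type u} [NormedAddCommGroup E'] [NormedSpace ℝ E'] {H' : Type u} [TopologicalSpace H']
  {I' : ModelWithCorners ℝ E' H'} {N : Type u} [TopologicalSpace N] [ChartedSpace H' N]
  [IsManifold I ∞ M] [IsManifold I' ∞ N] {k l : ℕ}

/-- **Leibniz rule for the external product with a cocycle in the first factor**, pointwise on
`W`: if `η` is smooth on `W` with `d_W η = 0` and `γ` is a smooth form on `N`, then
`d(π₁^* η ∧ π₂^* γ) = (-1)ᵏ π₁^* η ∧ π₂^* dγ` at the points of `π₁⁻¹ W` (Warner (1983),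
Thm. 2.20 / Prop. 2.23). [cite: WarnerGTM94, Thm. 2.20] -/
theorem mextDeriv_extProd_apply_of_localD_eq_zero {W : Set M} {η : MForm I M ℝ k} (hη : η ∈ smoothFormsOn I ℝ W k)
    (hdη : (mextDeriv η).restr W = 0) {γ : MForm I' N ℝ l} (hγ : IsSmoothForm γ) {p : M × N} (hp : p.1 ∈ W) :
    mextDeriv (η.extProd γ) p = (((-1 : ℝ) ^ k) • η.extProd (mextDeriv γ)) p := by
  have h1 : (η.pullback (I.prod I') Prod.fst).SmoothAt p :=
    MForm.SmoothAt.pullback (Eventually.of_forall fun _ ↦ contMDiffAt_fst) (hη.1 _ hp)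
  have h2 : (γ.pullback (I.prod I') Prod.snd).SmoothAt p :=
    MForm.SmoothAt.pullback (Eventually.of_forall fun _ ↦ contMDiffAt_snd) (hγ _)
  rw [extProd, mextDeriv_wedge_apply_of_smoothAt h1 h2]
  -- the first term vanishes: `d(π₁^* η) p = π₁^*(d_W η) p = 0`
  have hd0 : mextDeriv η p.1 = 0 := by
    have := congrFun hdη p.1
    rwa [restr_apply_of_mem _ hp] at this
  have hd1 : mextDeriv (η.pullback (I.prod I') Prod.fst) p = 0 := by
    rw [mextDeriv_pullback_apply (Eventually.of_forall fun _ ↦ contMDiffAt_fst) (hη.1 _ hp)]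
    ext v
    rw [pullback_apply, hd0]
    rfl
  have h0 : ((mextDeriv (η.pullback (I.prod I') Prod.fst)).wedge (γ.pullback (I.prod I') Prod.snd)) p =
      (0 : MForm (I.prod I') (M × N) ℝ _) p := by
    rw [wedge_apply, hd1]
    exact ContinuousAlternatingMap.zero_wedge _
  rw [castDeg_apply_congr _ h0, castDeg_zero, Pi.zero_apply, zero_add]
  -- the second term: `d(π₂^* γ) = π₂^* dγ`
  rw [mextDeriv_pullback contMDiff_snd hγ]
  rfl

end Literature.Geometry.Kaehler.MForm

namespace Literature.Geometry.Manifold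

variable {E : Type u} [NormedAddCommGroup E] [NormedSpace ℝ E] {H : Type u} [TopologicalSpace H]
  {I : ModelWithCorners ℝ E H} {M : Type u} [TopologicalSpace M] [ChartedSpace H M]
  [IsManifold I ∞ M] [I.Boundaryless] [FiniteDimensional ℝ E] [T2Space M] [SecondCountableTopology M]
  [LocallyCompactSpace M]
  {E' : Type u} [NormedAddCommGroup E'] [NormedSpace ℝ E'] {H' : Type u} [TopologicalSpace H']
  {I' : ModelWithCorners ℝ E' H'} {N : Type u} [TopologicalSpace N] [ChartedSpace H' N] [IsManifold I' ∞ N]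
  [I'.Boundaryless] [FiniteDimensional ℝ E'] [T2Space N] [SecondCountableTopology N] [LocallyCompactSpace N]
  {k l n : ℕ}

/-! ### The external product with an exact form is a coboundary -/

omit [I.Boundaryless] [FiniteDimensional ℝ E] [T2Space M] [SecondCountableTopology M] [LocallyCompactSpace M]
  [I'.Boundaryless] [FiniteDimensional ℝ E'] [T2Space N] [SecondCountableTopology N] [LocallyCompactSpace N] in
/-- **`π₁^* η ∧ π₂^* dγ = (-1)ᵏ d_{π₁⁻¹W}(π₁^* η ∧ π₂^* γ)` in `Ω•(π₁⁻¹ W)`** for a cocycle `η` of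
`Ω•(W)` and `β = dγ`. [cite: BottTu1982Forms, §I.5] -/
theorem localDeRhamComplex.extProdMap_app_eq_d {W : Set M} (hW : IsOpen W) {l' : ℕ} (β : closedSmoothForms I' N ℝ (l' + 1))
    (γ : (localDeRhamComplex I' ℝ (isOpen_univ : IsOpen (univ : Set N))).X l')
    (hγ : (localDeRhamComplex I' ℝ (isOpen_univ : IsOpen (univ : Set N))).d l' (l' + 1) γ = closedToUniv I' N ℝ (l' + 1) β)
    (η : (localDeRhamComplex I ℝ hW).X k) (hη : (localDeRhamComplex I ℝ hW).d k (k + 1) η = 0) :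
    (localDeRhamComplex.extProdMap N hW β).app k (k + l' + 1) rfl η =
      (localDeRhamComplex (I.prod I') ℝ (isOpen_preimage_fst (N := N) hW)).d (k + l') (k + l' + 1)
        (((-1 : ℝ) ^ k) • (⟨(η.1 : MForm I M ℝ k).extProd (γ.1 : MForm I' N ℝ l'),
          MForm.extProd_mem_smoothFormsOn η.2 fun x ↦ γ.2.1 x (mem_univ x)⟩ :
            (localDeRhamComplex (I.prod I') ℝ (isOpen_preimage_fst (N := N) hW)).X (k + l'))) := by
  -- `dγ = β` as forms and `d_W η = 0`
  have hγ' : mextDeriv (γ.1 : MForm I' N ℝ l') = (β.1 : MForm I' N ℝ (l' + 1)) := by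
    have := congrArg Subtype.val hγ
    rw [localDeRhamComplex_d_apply, coe_localD, MForm.restr_univ] at this
    exact this
  have hη' : (mextDeriv (η.1 : MForm I M ℝ k)).restr W = 0 := by
    have := congrArg Subtype.val hη
    rw [localDeRhamComplex_d_apply, coe_localD] at this
    exact this
  rw [map_smul, localDeRhamComplex_d_apply]
  refine Subtype.ext (funext fun p ↦ ?_)
  rw [localDeRhamComplex.extProdMap_app_coe, MForm.castDeg_rfl]
  change _ = (((-1 : ℝ) ^ k) • (mextDeriv ((η.1 : MForm I M ℝ k).extProd (γ.1 : MForm I' N ℝ l'))).restr (Prod.fst ⁻¹' W)) p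
  by_cases hp : p.1 ∈ W
  · rw [Pi.smul_apply, MForm.restr_apply_of_mem _ (show p ∈ Prod.fst ⁻¹' W from hp),
      MForm.mextDeriv_extProd_apply_of_localD_eq_zero η.2 hη' (fun x ↦ γ.2.1 x (mem_univ x)) hp, Pi.smul_apply,
      smul_smul, ← pow_add, ← two_mul, pow_mul, neg_one_sq, one_pow, one_smul, hγ']
  · rw [Pi.smul_apply, MForm.restr_apply_of_notMem _ (show p ∉ Prod.fst ⁻¹' W from hp), smul_zero]
    exact MForm.extProd_apply_eq_zero_of_left _ (η.2.2 _ hp)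

omit [I.Boundaryless] [FiniteDimensional ℝ E] [T2Space M] [SecondCountableTopology M] [LocallyCompactSpace M]
  [I'.Boundaryless] [FiniteDimensional ℝ E'] [T2Space N] [SecondCountableTopology N] [LocallyCompactSpace N] in
/-- **The external product with an exact closed form is zero on cohomology**: if `[β] = 0` in
`Hˡ(Ω•(N))` then `extProdH β = 0`. [cite: BottTu1982Forms, §I.5] -/
theorem localDeRhamComplex.extProdH_eq_zero_of_closedToLocalHomology_eq_zero {W : Set M} (hW : IsOpen W)
    (β : closedSmoothForms I' N ℝ l) (hb : closedToLocalHomology I' N ℝ l β = 0) (h : k + l = n)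
    (y : (localDeRhamComplex I ℝ hW).homology k) : localDeRhamComplex.extProdH N hW β k n h y = 0 := by
  obtain ⟨η, hη, rfl⟩ := homologyCls_surjective y
  rw [localDeRhamComplex.extProdH_homologyCls]
  have hη' : (localDeRhamComplex I ℝ hW).d k (k + 1) η = 0 := (d_next_eq_zero_iff (SimplexSpan.symm_down_next k) _).1 hη
  change homologyCls (closedToUniv I' N ℝ l β) (d_closedToUniv β) = 0 at hb
  rw [homologyCls_eq_zero_iff] at hb
  cases l with
  | zero =>
    -- `β = 0`
    rw [exists_d_prev_eq_iff symm_down_prev_zero] at hb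
    obtain ⟨w, hw⟩ := hb
    rw [d_prev_zero_apply] at hw
    have hβ0 : (β.1 : MForm I' N ℝ 0) = 0 := (congrArg Subtype.val hw).symm
    have happ : (localDeRhamComplex.extProdMap N hW β).app k n h η = 0 := by
      refine Subtype.ext ?_
      rw [localDeRhamComplex.extProdMap_app_coe, hβ0, MForm.extProd_def, MForm.pullback_zero, MForm.wedge_zero,
        MForm.castDeg_zero]
      rfl
    exact (homologyCls_congr happ _ (by rw [map_zero])).trans (homologyCls_zero _)
  | succ l' =>
    rw [exists_d_prev_eq_iff (SimplexSpan.symm_down_prev_succ l')] at hb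
    obtain ⟨γ, hγ⟩ := hb
    subst h
    rw [homologyCls_eq_zero_iff, exists_d_prev_eq_iff (show (ComplexShape.down ℕ).symm.prev (k + (l' + 1)) = k + l' from
      SimplexSpan.symm_down_prev_succ (k + l'))]
    exact ⟨_, (localDeRhamComplex.extProdMap_app_eq_d hW β γ hγ η hη').symm⟩

/-- **`lhs` vanishes for an exact second factor.** [cite: BottTu1982Forms, §I.5] -/
theorem lhs_eq_zero_of_closedToLocalHomology_eq_zero {W : Set M} (hW : IsOpen W) (β : closedSmoothForms I' N ℝ l)
    (hb : closedToLocalHomology I' N ℝ l β = 0) (h : k + l = n) (a : (localDeRhamComplex I ℝ hW).homology k) :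
    lhs N hW β k n h a = 0 := by
  rw [lhs_apply, localDeRhamComplex.extProdH_eq_zero_of_closedToLocalHomology_eq_zero hW β hb h a, map_zero]

/-! ### The right-hand side for an exact second factor -/

/-- If `[β] = 0` then the good representative `b_β` is a coboundary of `Hom(C(N), ℝ)`. [folklore] -/
theorem exists_d_eq_goodRep_of_closedToLocalHomology_eq_zero (β : closedSmoothForms I' N ℝ l)
    (hb : closedToLocalHomology I' N ℝ l β = 0) :
    ∃ w : (subsetCochains ℝ realCoeff.{u} (univ : Set N)).X ((ComplexShape.down ℕ).symm.prev l),
      (subsetCochains ℝ realCoeff.{u} (univ : Set N)).d _ l w = goodRep β := by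
  rw [← homologyCls_eq_zero_iff _ (d_goodRep β), homologyCls_goodRep, comparisonCls, hb, map_zero]

omit [IsManifold I ∞ M] [I.Boundaryless] [FiniteDimensional ℝ E] [T2Space M] [SecondCountableTopology M]
  [LocallyCompactSpace M] in
/-- **`π₂^♯ b_β` is a coboundary when `[β] = 0`** (positive degree). [folklore] -/
theorem exists_prodFun_eq_d_of_closedToLocalHomology_eq_zero {l' : ℕ} (β : closedSmoothForms I' N ℝ (l' + 1))
    (hb : closedToLocalHomology I' N ℝ (l' + 1) β = 0) :
    ∃ α : SingularSimplex (M × N) l' → ℝ,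
      prodFun M β - 0 = (singularCochainComplex ℝ ℝ (M × N)).d l' (l' + 1) α := by
  obtain ⟨w, hw⟩ := exists_d_eq_goodRep_of_closedToLocalHomology_eq_zero β hb
  refine ⟨(singularCochainComplex.map ℝ ℝ (sndCM M N)).f l' ((SimplexSpan.ofSet (R := ℝ) (univ : Set N)).toFun
    ((HomologicalComplex.XIsoOfEq (subsetCochains ℝ realCoeff.{u} (univ : Set N))
      (SimplexSpan.symm_down_prev_succ l')).hom w)), ?_⟩
  rw [sub_zero, ← ModuleCat.comp_apply, (singularCochainComplex.map ℝ ℝ (sndCM M N)).comm l' (l' + 1),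
    ModuleCat.comp_apply]
  have hd : (singularCochainComplex ℝ ℝ N).d l' (l' + 1) ((SimplexSpan.ofSet (R := ℝ) (univ : Set N)).toFun
      ((HomologicalComplex.XIsoOfEq (subsetCochains ℝ realCoeff.{u} (univ : Set N))
        (SimplexSpan.symm_down_prev_succ l')).hom w)) = goodFun β := by
    funext τ
    rw [← (SimplexSpan.ofSet (R := ℝ) (univ : Set N)).toFun_d _ (subset_univ _)]
    have hw' : (SimplexSpan.ofSet (R := ℝ) (univ : Set N)).cochains.d l' (l' + 1)
        ((HomologicalComplex.XIsoOfEq (subsetCochains ℝ realCoeff.{u} (univ : Set N))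
          (SimplexSpan.symm_down_prev_succ l')).hom w) = goodRep β := by
      rw [← hw]
      exact congrArg (fun φ ↦ (ModuleCat.Hom.hom φ) w)
        ((subsetCochains ℝ realCoeff.{u} (univ : Set N)).XIsoOfEq_hom_comp_d (SimplexSpan.symm_down_prev_succ l') (l' + 1))
    rw [hw']
    rfl
  rw [hd, prodFun]

/-- **`rhs` vanishes for an exact second factor.** [cite: HatcherAT2002, Lemma 3.6] -/
theorem rhs_eq_zero_of_closedToLocalHomology_eq_zero {W : Set M} (hW : IsOpen W) (β : closedSmoothForms I' N ℝ l)
    (hb : closedToLocalHomology I' N ℝ l β = 0) (h : k + l = n) (a : (localDeRhamComplex I ℝ hW).homology k) :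
    rhs N hW β k n h a = 0 := by
  rw [rhs_apply]
  cases l with
  | zero =>
    -- degree `0`: `b_β = 0`, so `π₂^♯ b_β = 0`
    obtain ⟨w, hw⟩ := exists_d_eq_goodRep_of_closedToLocalHomology_eq_zero β hb
    have h0 : goodRep β = 0 := by
      rw [← hw, (subsetCochains ℝ realCoeff.{u} (univ : Set N)).shape _ _ (by
        simp only [ComplexShape.symm_Rel, ComplexShape.down_Rel]; omega)]
      rfl
    have hP : prodFun M β = 0 := by
      rw [prodFun, goodFun, h0, SimplexSpan.toFun_zero, map_zero]
    have hz : (singularCochainComplex ℝ ℝ (M × N)).d 0 (0 + 1) (0 : SingularSimplex (M × N) 0 → ℝ) = 0 := map_zero _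
    rw [cupRightH_congr_cocycle _ _ (d_prodFun β) hz hP h]
    exact SimplexSpan.cupRightH_zero_cochain _ _ hz h _
  | succ l' =>
    obtain ⟨α, hα⟩ := exists_prodFun_eq_d_of_closedToLocalHomology_eq_zero (M := M) β hb
    have hz : (singularCochainComplex ℝ ℝ (M × N)).d (l' + 1) (l' + 1 + 1) (0 : SingularSimplex (M × N) (l' + 1) → ℝ) = 0 :=
      map_zero _
    rw [(SimplexSpan.ofSet (R := ℝ) _).cupRightH_congr (SimplexSpan.frontBackClosed_ofSet _) _ 0 (d_prodFun β) hz α hα h _]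
    exact SimplexSpan.cupRightH_zero_cochain _ _ hz h _

end Literature.Geometry.Manifold
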